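import Mathlib.RepresentationTheory.Homological.GroupCohomology.LowDegree
import Mathlib.LinearAlgebra.BilinearForm.Properties
import Mathlib.LinearAlgebra.Basis.VectorSpace
import Literature.AlgebraicGeometry.HodgeTheory.LocallyTrivialExtensionClasses
import Summits.HodgeConjecture.HodgeConjecture.Theorems.LinearSystemTorelliLocalTubeSpanAlgebra
import Summits.HodgeConjecture.HodgeConjecture.Theorems.LinearSystemTorelliLocalTubeSpanFrame

/-!
# Route LinearSystemTorelli — crux `LocalTubeSpan`: reduction to a sub-configuration

Helper file (`--supports stmt-HodgeConjecture-2490`, line `Sketch`, stub `stub_reduction`).  The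
crux ("local Schnell theorem") asks that Schnell's third map
`evalCoinv A : H¹(G, V) → ∏_{g ∈ G} V/(g - 1)V` of C. Schnell, *Primitive cohomology and the tube
mapping*, Math. Z. 268 (2010) §3, §7, be injective for the local monodromy groups `G`, which are
generated by a set `s` of Picard–Lefschetz transvections `t(x) = x - B(x, e_t) e_t` along local
vanishing cycles `e_t` of a nondegenerate bilinear form `B` on the finite-dimensional space `V`
(C. Voisin, *Hodge Theory and Complex Algebraic Geometry II* (2003) Thm. 3.16).  The present file
proves the SUB-CONFIGURATION REDUCTION used to glue the two detection mechanisms of the line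
(the transvection frame of `LinearSystemTorelliLocalTubeSpanFrame` and the rank-drop elements of
`LinearSystemTorelliLocalTubeSpanNCNodal`) at mixed points of the discriminant:

* `localTubeSpan_injective_evalCoinv_of_subconfiguration` — if the third map of the subgroup
  generated by a sub-configuration `s' ⊆ s` is injective and the remaining cycles `e_t`,
  `t ∈ s ∖ s'`, are linearly independent modulo `span {e_t : t ∈ s'}` (all relations among the
  vanishing cycles are supported on `s'`), then the third map of `G` is injective.

Proof: an undetected cocycle `φ` restricts to an undetected cocycle of `⟨s'⟩`, which is a
coboundary `dv` by hypothesis; `φ' = φ - dv` vanishes on `s'`, is still undetected, so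
`φ'(t) = a_t e_t` for `t ∈ s`.  By the independence hypothesis there is a linear functional `F`
on `V` killing `span {e_t : t ∈ s'}` with `F(e_t) = -a_t` for `t ∈ s ∖ s'`; by nondegeneracy
`F = B(x, ·)`, and then `dx(t) = -B(x, e_t) e_t` agrees with `φ'(t)` at every generator, so
`φ' = dx` on `⟨s⟩ = G` and `φ = d(v + x)` is a coboundary.  Everything is over an arbitrary field
and group; no named facts.
-/

-- `Summit.HodgeConjecture.HodgeConjecture.Theorems` is the mandated namespace (single-conjunct summit:
-- Sub = Summit), which `linter.dupNamespace` flags on every declaration; the lakefile turns the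
-- linter off tree-wide (weak option), restated here so stand-alone elaboration is warning-free too.
set_option linter.dupNamespace false

noncomputable section

open CategoryTheory groupCohomology
open Literature.AlgebraicGeometry.HodgeTheory

namespace Summit.HodgeConjecture.HodgeConjecture.Theorems

universe u

section General

variable {k G : Type u} [CommRing k] [Group G] (A : Rep k G)

/-- If Schnell's third map of `A|_S` is injective, then a `1`-cocycle of `G` undetected by every
element of the subgroup `S` (`φ g ∈ (g - 1)A` for `g ∈ S`) restricts to a coboundary on `S`:
`φ g = g·v - v` for all `g ∈ S` and a single vector `v`. [folklore] -/
theorem localTubeSpan_exists_sub_eq_of_injective_evalCoinv_res (S : Subgroup G)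
    (hinj : Function.Injective (evalCoinv (Rep.res S.subtype A))) (φ : cocycles₁ A)
    (hφ : ∀ g ∈ S, (φ : G → A.V) g ∈ subOneRange A g) :
    ∃ v : A.V, ∀ g ∈ S, A.ρ g v - v = (φ : G → A.V) g := by
  have hker : H1π A φ ∈ LinearMap.ker (evalCoinvOn A S) := by
    rw [LinearMap.mem_ker]
    funext g
    rw [evalCoinvOn_H1π, Pi.zero_apply, Submodule.mkQ_apply, Submodule.Quotient.mk_eq_zero]
    exact hφ g g.2
  rw [localTubeSpan_ker_evalCoinvOn_eq_H1resKer_of_injective A S hinj, H1resKer_mk_iff] at hker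
  exact hker

end General

section Reduction

/-- **Sub-configuration reduction** for the local Schnell theorem.  Let `G`, generated by a set
`s`, act on a finite-dimensional space `A` carrying a nondegenerate bilinear form `B` through
Picard–Lefschetz transvections `t(x) = x - B(x, e_t) e_t` (`t ∈ s`).  If Schnell's third map of
the subgroup generated by a sub-configuration `s' ⊆ s` is injective, and the remaining vectors
`e_t`, `t ∈ s ∖ s'`, are linearly independent modulo `span {e_t : t ∈ s'}` (every linear relation
among the `e_t` is supported on `s'`), then Schnell's third map
`H¹(G, A) → ∏_{g ∈ G} A/(g - 1)A` of `G` is injective (coboundary adjustment on `⟨s'⟩`, then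
`B`-duality on the independent directions, as in [Schnell2010] §7, proof of Prop. 12). [folklore] -/
theorem localTubeSpan_injective_evalCoinv_of_subconfiguration {k G : Type u} [Field k] [Group G]
    (A : Rep k G) [FiniteDimensional k A.V] (B : LinearMap.BilinForm k A.V)
    (hB : B.Nondegenerate) (s : Set G) (hs : Subgroup.closure s = ⊤) (e : G → A.V)
    (hPL : ∀ t ∈ s, ∀ x : A.V, A.ρ t x = x - B x (e t) • e t)
    (s' : Set G) (hs' : s' ⊆ s)
    (hinj : Function.Injective (evalCoinv (Rep.res (Subgroup.closure s').subtype A)))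
    (hind : LinearIndependent k
      (fun t : ↥(s \ s') => (Submodule.span k (e '' s')).mkQ (e t))) :
    Function.Injective (evalCoinv A) := by
  refine (injective_iff_map_eq_zero _).2 fun ξ hξ => ?_
  induction ξ using H1_induction_on with
  | h φ =>
  -- `φ` is undetected by every element of `G`
  have hund : ∀ g : G, (φ : G → A.V) g ∈ subOneRange A g := fun g => by
    have := congr_fun hξ g
    rwa [evalCoinv_H1π, Pi.zero_apply, Submodule.mkQ_apply, Submodule.Quotient.mk_eq_zero]
      at this
  -- Step 1: restricted to `⟨s'⟩` the cocycle is undetected, hence the coboundary of some `v`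
  obtain ⟨v, hv⟩ := localTubeSpan_exists_sub_eq_of_injective_evalCoinv_res A
    (Subgroup.closure s') hinj φ fun g _ => hund g
  -- Step 2: `φ' = φ - dv` vanishes on `s'`, is undetected, and `φ'(t) ∈ k·e_t` for `t ∈ s`
  obtain ⟨φ', hφ'apply⟩ : ∃ φ' : cocycles₁ A,
      ∀ g, (φ' : G → A.V) g = (φ : G → A.V) g - (A.ρ g v - v) :=
    ⟨φ - ⟨d₀₁ A v, d₀₁_apply_mem_cocycles₁ v⟩, fun g => by
      change (φ : G → A.V) g - d₀₁ A v g = _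
      rw [d₀₁_hom_apply]⟩
  have hφ's' : ∀ t ∈ s', (φ' : G → A.V) t = 0 := fun t ht => by
    rw [hφ'apply, hv t (Subgroup.subset_closure ht), sub_self]
  have hund' : ∀ g : G, ∃ w : A.V, A.ρ g w - w = (φ' : G → A.V) g := fun g => by
    obtain ⟨u, hu⟩ := hund g
    refine ⟨u - v, ?_⟩
    rw [hφ'apply, ← hu, LinearMap.sub_apply, LinearMap.id_apply, map_sub]
    abel
  choose w hw using hund'
  have hφ't : ∀ t ∈ s, (φ' : G → A.V) t = -(B (w t) (e t) • e t) := fun t ht => by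
    rw [← hw t, hPL t ht, sub_sub_cancel_left]
  -- Step 3: a linear functional killing `e '' s'`, with the values `B (w t) (e t)` on the other
  -- `e t` (they are linearly independent modulo the span of `e '' s'`)
  obtain ⟨F, hF₁, hF₂⟩ : ∃ F : A.V →ₗ[k] k, (∀ t ∈ s', F (e t) = 0) ∧
      ∀ t ∈ s, t ∉ s' → F (e t) = B (w t) (e t) := by
    obtain ⟨gl, hgl⟩ := LinearMap.exists_leftInverse_of_injective
      (Finsupp.linearCombination k fun t : ↥(s \ s') => (Submodule.span k (e '' s')).mkQ (e t))
      (LinearMap.ker_eq_bot.2 hind)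
    refine ⟨(Finsupp.linearCombination k fun t : ↥(s \ s') => B (w t) (e t)) ∘ₗ gl ∘ₗ
      (Submodule.span k (e '' s')).mkQ, fun t ht => ?_, fun t ht ht' => ?_⟩
    · have hmem : e t ∈ Submodule.span k (e '' s') := Submodule.subset_span ⟨t, ht, rfl⟩
      rw [LinearMap.comp_apply, LinearMap.comp_apply, Submodule.mkQ_apply,
        (Submodule.Quotient.mk_eq_zero _).2 hmem, map_zero, map_zero]
    · have e1 : (Submodule.span k (e '' s')).mkQ (e t) = Finsupp.linearCombination k
          (fun t : ↥(s \ s') => (Submodule.span k (e '' s')).mkQ (e t))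
          (Finsupp.single ⟨t, ht, ht'⟩ 1) := by
        rw [Finsupp.linearCombination_single, one_smul]
      have e2 := LinearMap.congr_fun hgl (Finsupp.single (⟨t, ht, ht'⟩ : ↥(s \ s')) 1)
      rw [LinearMap.comp_apply, LinearMap.id_apply] at e2
      rw [LinearMap.comp_apply, LinearMap.comp_apply, e1, e2, Finsupp.linearCombination_single,
        one_smul]
  -- Step 4: `F = B(x, ·)` by nondegeneracy; `dx` agrees with `φ'` on every generator
  obtain ⟨x, hx⟩ : ∃ x : A.V, ∀ y, B x y = F y :=
    ⟨(B.toDual hB).symm F, fun y => LinearMap.BilinForm.apply_toDual_symm_apply F y⟩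
  obtain ⟨ψ, hψapply⟩ : ∃ ψ : cocycles₁ A,
      ∀ g, (ψ : G → A.V) g = (φ' : G → A.V) g - (A.ρ g x - x) :=
    ⟨φ' - ⟨d₀₁ A x, d₀₁_apply_mem_cocycles₁ x⟩, fun g => by
      change (φ' : G → A.V) g - d₀₁ A x g = _
      rw [d₀₁_hom_apply]⟩
  have hgen₁ : ∀ t ∈ s', (ψ : G → A.V) t = 0 := fun t ht' => by
    rw [hψapply, hφ's' t ht', hPL t (hs' ht'), hx, hF₁ t ht']
    simp only [zero_smul, sub_zero, sub_self]
  have hgen₂ : ∀ t ∈ s, t ∉ s' → (ψ : G → A.V) t = 0 := fun t ht ht' => by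
    rw [hψapply, hφ't t ht, hPL t ht, hx, hF₂ t ht ht', sub_sub_cancel_left, sub_self]
  have hgen : ∀ t ∈ s, (ψ : G → A.V) t = 0 := fun t ht => by
    by_cases ht' : t ∈ s'
    · exact hgen₁ t ht'
    · exact hgen₂ t ht ht'
  -- Step 5: `ψ` vanishes on `⟨s⟩ = G`, i.e. `φ` is the coboundary of `v + x`
  have hall : ∀ g, (ψ : G → A.V) g = 0 := fun g =>
    localTubeSpan_cocycles₁_apply_eq_zero_of_mem_closure A ψ s hgen
      (by rw [hs]; exact Subgroup.mem_top g)
  rw [H1π_eq_zero_iff, mem_coboundaries₁_iff_exists]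
  refine ⟨v + x, fun g => ?_⟩
  have := hall g
  rw [hψapply, hφ'apply, sub_sub, sub_eq_zero] at this
  rw [this, map_add]
  abel

end Reduction

end Summit.HodgeConjecture.HodgeConjecture.Theorems

end
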